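import Summits.ValiantsHypothesis.ValiantsHypothesis.Theorems.BarrierLeverModelAxisCapstone
import Literature.Computability.AlgebraicComplexity.IMMInVPProofs
import Literature.Computability.AlgebraicComplexity.CircuitDepthProofs

/-!
# Route BarrierLever — MODEL axis of crux `DefinableEquations` (stmt-ValiantsHypothesis-8745) /
# item `SingleSizeEquations` (8749): the classical slices ARE sub-slices of the crux's class

The model-axis capstone (`ModelAxis.naturalProofsAgainstClassicalModels`, file
`…ModelAxisCapstone.lean`) gives ONE level-`21` distinguisher vanishing, for every `b` and all large
`n`, on the union `classicalSlices n (n^b)` of the five classical models (diagonal depth-3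
`ΣΛΣ`, homogeneous `ΣΠΣ`, bounded-formal-degree `ΣΠΣ`, read-once oblivious ABPs of ANY order and
width `n^b`, fan-in-two formulas of size `≤ n²/20`).  For the two `ΣΠΣ` slices the tree records
that they lie INSIDE the crux's class `SmallCircuits ℂ n (b+3)` (`sigmaPiSigmaSlice_subset_smallCircuits`,
`sigmaPiSigmaLowDegSlice_subset_smallCircuits`); for the other three the inclusion was left open by
val-np-p5 g4 (NOTES: "roabpSlice ⊆ SmallCircuits needs a joint-computation size lemma").  This file
closes that gap, so that the capstone is — kernel-checked — the crux's own sentence restricted to a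
sub-slice `P ⊆ SmallCircuits ℂ n (2b+4)`:

* `complexity_rowChain_le` — the JOINT-COMPUTATION lemma: for `w × w` matrices `M₀,…,M_{N-1}`
  of polynomials with entries of size `≤ c`, the bilinear pairing `Σ_k y_k · (M₀ ⋯ M_{N-1})_{k,a}`
  of placeholder variables `y` with a column of the ordered product has size `≤ N · w² (c + 2)`
  (iterated substitution `y ↦ y · M_i`, one layer at a time, through the tree's
  `complexity_aeval_le` — the `w` entries of each intermediate row vector are computed ONCE);
* `complexity_le_of_isROABP` — hence a width-`w`, individual-degree-`d` roABP in `n` variables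
  (the tree's `IsROABP`, Forbes–Shpilka–Volk 2018 §5.3) computes a polynomial of size
  `≤ n · w² ((d+1)(d+2) + 2)`; `roabpSlice_subset_smallCircuits`:
  `roabpSlice n (n^b) ⊆ SmallCircuits ℂ n (2b+4)` for `n ≥ 4`;
* `sigmaLambdaSigmaSlice_subset_smallCircuits` — `ΣΛΣ` of top fan-in `n^b` lies in
  `SmallCircuits ℂ n (b+3)` (`n ≥ 3`); `formulaSlice_subset_smallCircuits` — formulas of size
  `≤ n²/20` lie in `SmallCircuits ℂ n 2` (`complexity_le_formulaComplexity_holds`);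
* `classicalSlices_subset_smallCircuits` — `classicalSlices n (n^b) ⊆ SmallCircuits ℂ n (2b+4)`
  for `n ≥ 4`; whence `isNaturalProof_classicalCert_inter`: for `n ≥ 162·16^b` the capstone's
  `classicalCert n` is a level-`21` natural proof against
  `SmallCircuits ℂ n (2b+4) ∩ classicalSlices n (n^b)` — an FSV-natural proof RELATIVE to the slice
  of the crux's class cut out by the classical models (barrier entry
  `AlgebraicNaturalProofsNarrow`), nothing more.

HONEST FRAMING: bookkeeping on the model axis; nothing here touches general circuits (`b ≥ 2` of
the crux is Chatterjee–Tengse 2023 §1.3 dir. 2, open), 8746, 14610 or VP vs VNP.  No definitions,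
no named facts.  References: [ForbesShpilkaVolk2018] §5.3 (roABPs, matrix form); [Burgisser2000]
§2.1, Rem. 2.7 (substitution); [Nisan1991Noncommutative] (the ROABP rung this completes).
-/

-- layout Summits/ValiantsHypothesis/ValiantsHypothesis forces the duplicated namespace component
set_option linter.dupNamespace false

noncomputable section

open MvPolynomial

namespace Summit.ValiantsHypothesis.ValiantsHypothesis.Theorems.BarrierLever.ModelAxis

open Literature.Computability.AlgebraicComplexity Literature.Barriers.ValiantsHypothesis
open SigmaLambdaSigmaSlice SigmaPiSigmaSlice ROABPSlice FormulaSlice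

/-! ## The joint-computation lemma: row vector times an ordered matrix product -/

section chain

variable {R : Type*} [CommSemiring R] {σ : Type*} {w : ℕ}

/-- `L(x^j) ≤ j` (inputs are free; `j` product gates). [cite: Burgisser2000, §2.1] -/
theorem complexity_X_pow_le' (v : σ) (j : ℕ) : complexity (X v ^ j : MvPolynomial σ R) ≤ j := by
  rw [Finset.pow_eq_prod_const]
  refine (complexity_finset_prod_le _ _).trans ?_
  rw [Finset.sum_eq_zero fun _ _ => complexity_X_holds (k := R) (σ := σ) v, Finset.card_range,
    zero_add]

/-- A univariate polynomial of degree `≤ d` read at a variable costs `≤ (d+1)(d+2)` gates (one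
scalar gate and `≤ j` products per term `p_j x^j`, `d` additions). [cite: Burgisser2000, §2.1] -/
theorem complexity_polynomial_aeval_X_le (v : σ) {p : Polynomial R} {d : ℕ} (hp : p.natDegree ≤ d) :
    complexity (Polynomial.aeval (X v : MvPolynomial σ R) p) ≤ (d + 1) * (d + 2) := by
  rw [Polynomial.aeval_eq_sum_range' (Nat.lt_succ_of_le hp)]
  refine (complexity_finset_sum_le _ _).trans ?_
  rw [Finset.card_range]
  have h : ∀ j ∈ Finset.range (d + 1),
      complexity (p.coeff j • (X v : MvPolynomial σ R) ^ j) ≤ d + 1 := by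
    intro j hj
    have hj' : j ≤ d := Nat.lt_succ_iff.mp (Finset.mem_range.mp hj)
    calc complexity (p.coeff j • (X v : MvPolynomial σ R) ^ j)
        ≤ complexity ((X v : MvPolynomial σ R) ^ j) + 1 := complexity_smul_le_holds _ _
      _ ≤ j + 1 := Nat.add_le_add_right (complexity_X_pow_le' v j) 1
      _ ≤ d + 1 := by omega
  calc ∑ j ∈ Finset.range (d + 1), complexity (p.coeff j • (X v : MvPolynomial σ R) ^ j) + (d + 1)
      ≤ ∑ _j ∈ Finset.range (d + 1), (d + 1) + (d + 1) := Nat.add_le_add_right (Finset.sum_le_sum h) _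
    _ = (d + 1) * (d + 2) := by rw [Finset.sum_const, Finset.card_range, smul_eq_mul]; ring

/-- **Joint computation of a row vector through a chain of matrices.**  For `M₀, …, M_{N-1}`
(`w × w` matrices of polynomials in the variables `σ`, every entry of size `≤ c`) and a column
index `a`, the pairing `Σ_k y_k · (M₀ ⋯ M_{N-1})_{k,a}` — a polynomial in placeholder variables
`y_k = X (inl k)` and the `σ`-variables `X (inr ·)` — has size `≤ N · w² (c + 2)`: substitute
`y_{k'} ↦ Σ_k y_k (M₀)_{k,k'}` (cost `w · w (c+2)`) into the pairing for `M₁ ⋯ M_{N-1}` and recurse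
(`complexity_aeval_le`; each layer is paid once, not once per entry). [cite: Burgisser2000, Rem. 2.7] -/
theorem complexity_rowChain_le [Fintype σ] (c : ℕ) :
    ∀ (N : ℕ) (M : Fin N → Matrix (Fin w) (Fin w) (MvPolynomial σ R)),
      (∀ i a b, complexity (M i a b) ≤ c) → ∀ a : Fin w,
        complexity (∑ k : Fin w, X (Sum.inl k) *
          rename (Sum.inr : σ → Fin w ⊕ σ) ((List.ofFn M).prod k a)) ≤ N * (w * (w * (c + 2)))
  | 0, M, _, a => by
    have h : (∑ k : Fin w, X (Sum.inl k) *
        rename (Sum.inr : σ → Fin w ⊕ σ) ((List.ofFn M).prod k a) : MvPolynomial (Fin w ⊕ σ) R) =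
        X (Sum.inl a) := by
      rw [List.ofFn_zero, List.prod_nil]
      simp only [Matrix.one_apply, apply_ite (rename (Sum.inr : σ → Fin w ⊕ σ)), map_one,
        map_zero, mul_ite, mul_one, mul_zero, Finset.sum_ite_eq', Finset.mem_univ, if_true]
    rw [h, complexity_X_holds, Nat.zero_mul]
  | N + 1, M, hM, a => by
    -- the substitution `y_{k'} ↦ Σ_k y_k (M 0)_{k k'}`, identity on the `σ`-variables
    set φ : Fin w ⊕ σ → MvPolynomial (Fin w ⊕ σ) R := Sum.elim
      (fun k' => ∑ k : Fin w, X (Sum.inl k) * rename (Sum.inr : σ → Fin w ⊕ σ) (M 0 k k'))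
      (fun j => X (Sum.inr j)) with hφ
    have hfix : ∀ g : MvPolynomial σ R,
        aeval φ (rename (Sum.inr : σ → Fin w ⊕ σ) g) = rename (Sum.inr : σ → Fin w ⊕ σ) g := by
      intro g
      rw [aeval_rename]
      have : (φ ∘ (Sum.inr : σ → Fin w ⊕ σ)) = X ∘ (Sum.inr : σ → Fin w ⊕ σ) := by
        funext j; simp [hφ]
      rw [this, rename_eq_aeval]
    have key : (∑ k : Fin w, X (Sum.inl k) *
          rename (Sum.inr : σ → Fin w ⊕ σ) ((List.ofFn M).prod k a) : MvPolynomial (Fin w ⊕ σ) R) =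
        aeval φ (∑ k' : Fin w, X (Sum.inl k') *
          rename (Sum.inr : σ → Fin w ⊕ σ) ((List.ofFn (fun i : Fin N => M i.succ)).prod k' a)) := by
      rw [List.ofFn_succ, List.prod_cons, map_sum]
      simp only [map_mul, aeval_X, hfix, Matrix.mul_apply, map_sum, Finset.mul_sum]
      rw [Finset.sum_comm]
      refine Finset.sum_congr rfl fun k' _ => ?_
      simp only [hφ, Sum.elim_inl, Finset.sum_mul, mul_assoc]
    rw [key]
    refine (complexity_aeval_le _ _).trans ?_
    have ih := complexity_rowChain_le c N (fun i => M i.succ) (fun i => hM i.succ) a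
    have hφle : ∑ v, complexity (φ v) ≤ w * (w * (c + 2)) := by
      rw [Fintype.sum_sum_type]
      have h2 : ∑ j : σ, complexity (φ (Sum.inr j)) = 0 :=
        Finset.sum_eq_zero fun j _ => by simp only [hφ, Sum.elim_inr]; exact complexity_X_holds _
      rw [h2, add_zero]
      calc ∑ k' : Fin w, complexity (φ (Sum.inl k'))
          ≤ ∑ _k' : Fin w, w * (c + 2) := Finset.sum_le_sum fun k' _ => by
            simp only [hφ, Sum.elim_inl]
            refine (complexity_finset_sum_le _ _).trans ?_
            rw [Finset.card_univ, Fintype.card_fin]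
            calc ∑ k : Fin w, complexity (X (Sum.inl k) *
                    rename (Sum.inr : σ → Fin w ⊕ σ) (M 0 k k') : MvPolynomial (Fin w ⊕ σ) R) + w
                ≤ ∑ _k : Fin w, (c + 1) + w := by
                  refine Nat.add_le_add_right (Finset.sum_le_sum fun k _ => ?_) _
                  calc complexity (X (Sum.inl k) *
                        rename (Sum.inr : σ → Fin w ⊕ σ) (M 0 k k') : MvPolynomial (Fin w ⊕ σ) R)
                      ≤ complexity (X (Sum.inl k) : MvPolynomial (Fin w ⊕ σ) R) +
                          complexity (rename (Sum.inr : σ → Fin w ⊕ σ) (M 0 k k')) + 1 :=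
                        complexity_mul_le_holds _ _
                    _ ≤ 0 + c + 1 := by
                        refine Nat.add_le_add_right (Nat.add_le_add (complexity_X_holds _).le
                          ((complexity_rename_le_holds' _ _).trans (hM 0 k k'))) 1
                    _ = c + 1 := by ring
              _ = w * (c + 2) := by
                  rw [Finset.sum_const, Finset.card_univ, Fintype.card_fin, smul_eq_mul]; ring
        _ = w * (w * (c + 2)) := by
            rw [Finset.sum_const, Finset.card_univ, Fintype.card_fin, smul_eq_mul]
    calc complexity (∑ k' : Fin w, X (Sum.inl k') *
            rename (Sum.inr : σ → Fin w ⊕ σ) ((List.ofFn (fun i : Fin N => M i.succ)).prod k' a)) +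
          ∑ v, complexity (φ v)
        ≤ N * (w * (w * (c + 2))) + w * (w * (c + 2)) := Nat.add_le_add ih hφle
      _ = (N + 1) * (w * (w * (c + 2))) := by ring

/-- **An entry of an ordered matrix product is cheap**: `(M₀ ⋯ M_{N-1})_{a₀,a}` has size
`≤ N · w² (c + 2)` (specialise the placeholder row vector to the unit vector `e_{a₀}`; constants
and variables are free). [cite: Burgisser2000, Rem. 2.7] -/
theorem complexity_listProd_apply_le [Fintype σ] (c : ℕ) (N : ℕ)
    (M : Fin N → Matrix (Fin w) (Fin w) (MvPolynomial σ R)) (hM : ∀ i a b, complexity (M i a b) ≤ c)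
    (a₀ a : Fin w) :
    complexity ((List.ofFn M).prod a₀ a) ≤ N * (w * (w * (c + 2))) := by
  classical
  set ψ : Fin w ⊕ σ → MvPolynomial σ R :=
    Sum.elim (fun k => if k = a₀ then 1 else 0) (fun j => X j) with hψ
  have hfix : ∀ g : MvPolynomial σ R, aeval ψ (rename (Sum.inr : σ → Fin w ⊕ σ) g) = g := by
    intro g
    rw [aeval_rename]
    have : (ψ ∘ (Sum.inr : σ → Fin w ⊕ σ)) = X := by funext j; simp [hψ]
    rw [this, aeval_X_left, AlgHom.coe_id, id_eq]
  have key : (List.ofFn M).prod a₀ a = aeval ψ (∑ k : Fin w, X (Sum.inl k) *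
      rename (Sum.inr : σ → Fin w ⊕ σ) ((List.ofFn M).prod k a)) := by
    rw [map_sum]
    simp only [map_mul, aeval_X, hfix]
    simp only [hψ, Sum.elim_inl, ite_mul, one_mul, zero_mul, Finset.sum_ite_eq', Finset.mem_univ,
      if_true]
  rw [key]
  refine (complexity_aeval_le _ _).trans ?_
  have h0 : ∑ v, complexity (ψ v) = 0 := by
    refine Finset.sum_eq_zero fun v _ => ?_
    rcases v with k | j
    · simp only [hψ, Sum.elim_inl]
      split_ifs
      · rw [← C_1]; exact complexity_C_holds _
      · rw [← C_0]; exact complexity_C_holds _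
    · simp only [hψ, Sum.elim_inr]; exact complexity_X_holds _
  rw [h0, add_zero]
  exact complexity_rowChain_le c N M hM a

end chain

/-! ## roABPs are small circuits -/
section roabp

variable {n : ℕ}

/-- **Size of a read-once oblivious ABP as a fan-in-two circuit**: a width-`w` roABP with edge
labels of individual degree `≤ d` (the tree's `IsROABP`, any order `π`) computes a polynomial of
size `≤ n · w² ((d+1)(d+2) + 2)`. [cite: ForbesShpilkaVolk2018, §5.3 (definition of roABP)] -/
theorem complexity_le_of_isROABP {w d : ℕ} {π : Fin n ≃ Fin n} {f : MvPolynomial (Fin n) ℂ}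
    (hf : IsROABP ℂ w d π f) :
    complexity f ≤ n * (w * (w * ((d + 1) * (d + 2) + 2))) := by
  obtain ⟨hw, M, hM, rfl⟩ := hf
  refine complexity_listProd_apply_le ((d + 1) * (d + 2)) n M (fun i a b => ?_) _ _
  obtain ⟨p, hp, hpab⟩ := hM i a b
  rw [hpab]
  exact complexity_polynomial_aeval_X_le (π i) hp

/-- Arithmetic: `n · n^b · n^b · ((n+1)(n+2) + 2) ≤ n^(2b+4)` for `n ≥ 4`. [folklore] -/
theorem roabp_arith {b : ℕ} (hn : 4 ≤ n) :
    n * (n ^ b * (n ^ b * ((n + 1) * (n + 2) + 2))) ≤ n ^ (2 * b + 4) := by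
  have h1 : (n + 1) * (n + 2) + 2 ≤ n ^ 3 := by
    calc (n + 1) * (n + 2) + 2 ≤ n * (n * n) := by nlinarith
      _ = n ^ 3 := by ring
  calc n * (n ^ b * (n ^ b * ((n + 1) * (n + 2) + 2))) ≤ n * (n ^ b * (n ^ b * n ^ 3)) :=
        Nat.mul_le_mul_left _ (Nat.mul_le_mul_left _ (Nat.mul_le_mul_left _ h1))
    _ = n ^ (2 * b + 4) := by ring

/-- **The ROABP slice is a sub-slice of the crux's class**: for `n ≥ 4`,
`roabpSlice n (n^b) ⊆ SmallCircuits ℂ n (2b + 4)` (degree `≤ n` by definition of the slice; size by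
`complexity_le_of_isROABP` with `w = n^b`, `d = n`). [cite: ForbesShpilkaVolk2018, §5.3] -/
theorem roabpSlice_subset_smallCircuits {b : ℕ} (hn : 4 ≤ n) :
    roabpSlice n (n ^ b) ⊆ SmallCircuits ℂ n (2 * b + 4) := by
  rintro f ⟨hdeg, π, hf⟩
  exact ⟨hdeg, (complexity_le_of_isROABP hf).trans (roabp_arith hn)⟩

end roabp

/-! ## The diagonal depth-3 slice and the formula slice are small circuits -/

section sls

variable {n : ℕ}

/-- `L(u^k) ≤ k (L(u) + 1)`. [cite: Burgisser2000, §2.1] -/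
theorem complexity_pow_le' {σ : Type*} (u : MvPolynomial σ ℂ) (k : ℕ) :
    complexity (u ^ k) ≤ k * (complexity u + 1) := by
  induction k with
  | zero => rw [pow_zero, ← C_1, complexity_C_holds]; exact Nat.zero_le _
  | succ k ih =>
    rw [pow_succ]
    calc complexity (u ^ k * u) ≤ complexity (u ^ k) + complexity u + 1 := complexity_mul_le_holds _ _
      _ ≤ k * (complexity u + 1) + complexity u + 1 := by omega
      _ = (k + 1) * (complexity u + 1) := by ring

/-- An affine form `a₀ + Σ_μ a_μ x_μ` costs `≤ 2n + 1` gates. [cite: Burgisser2000, §2.1] -/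
theorem complexity_affineForm_le (a₀ : ℂ) (a : Fin n → ℂ) :
    complexity (C a₀ + ∑ μ ∈ (Finset.univ : Finset (Fin n)), C (a μ) * X μ :
      MvPolynomial (Fin n) ℂ) ≤ 2 * n + 1 := by
  have hsum : complexity (∑ μ ∈ (Finset.univ : Finset (Fin n)), C (a μ) * X μ :
      MvPolynomial (Fin n) ℂ) ≤ 2 * n := by
    refine (complexity_finset_sum_le _ _).trans ?_
    rw [Finset.card_univ, Fintype.card_fin]
    calc ∑ μ : Fin n, complexity (C (a μ) * X μ : MvPolynomial (Fin n) ℂ) + n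
        ≤ ∑ _μ : Fin n, 1 + n := by
          refine Nat.add_le_add_right (Finset.sum_le_sum fun μ _ => ?_) _
          calc complexity (C (a μ) * X μ : MvPolynomial (Fin n) ℂ)
              ≤ complexity (C (a μ) : MvPolynomial (Fin n) ℂ) +
                  complexity (X μ : MvPolynomial (Fin n) ℂ) + 1 := complexity_mul_le_holds _ _
            _ = 1 := by rw [complexity_C_holds, complexity_X_holds]
      _ = 2 * n := by rw [Finset.sum_const, Finset.card_univ, Fintype.card_fin, smul_eq_mul]; ring
  calc complexity (C a₀ + ∑ μ ∈ (Finset.univ : Finset (Fin n)), C (a μ) * X μ :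
        MvPolynomial (Fin n) ℂ)
      ≤ complexity (C a₀ : MvPolynomial (Fin n) ℂ) +
          complexity (∑ μ ∈ (Finset.univ : Finset (Fin n)), C (a μ) * X μ :
            MvPolynomial (Fin n) ℂ) + 1 := complexity_add_le_holds _ _
    _ ≤ 0 + 2 * n + 1 := by rw [complexity_C_holds]; omega
    _ = 2 * n + 1 := by ring

/-- **Size of a `ΣΛΣ` expression**: a member of `sigmaLambdaSigmaSlice n s` (a sum of `s` powers of
degree `≤ n` of affine forms) has size `≤ s (n (2n+2) + 2)`. [cite: NisanWigderson1996, §3] -/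
theorem complexity_le_of_mem_sigmaLambdaSigmaSlice {s : ℕ} {f : MvPolynomial (Fin n) ℂ}
    (hf : f ∈ sigmaLambdaSigmaSlice n s) : complexity f ≤ s * (n * (2 * n + 2) + 2) := by
  obtain ⟨c, a₀, a, d, hd, rfl⟩ := hf
  refine (complexity_finset_sum_le _ _).trans ?_
  rw [Finset.card_univ, Fintype.card_fin]
  have hterm : ∀ i : Fin s, complexity (C (c i) *
      (C (a₀ i) + ∑ μ ∈ (Finset.univ : Finset (Fin n)), C (a i μ) * X μ) ^ (d i) :
        MvPolynomial (Fin n) ℂ) ≤ n * (2 * n + 2) + 1 := by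
    intro i
    calc complexity (C (c i) *
          (C (a₀ i) + ∑ μ ∈ (Finset.univ : Finset (Fin n)), C (a i μ) * X μ) ^ (d i) :
            MvPolynomial (Fin n) ℂ)
        ≤ complexity (C (c i) : MvPolynomial (Fin n) ℂ) +
            complexity ((C (a₀ i) + ∑ μ ∈ (Finset.univ : Finset (Fin n)), C (a i μ) * X μ) ^ (d i) :
              MvPolynomial (Fin n) ℂ) + 1 := complexity_mul_le_holds _ _
      _ ≤ 0 + d i * (2 * n + 1 + 1) + 1 := by
          rw [complexity_C_holds]
          refine Nat.add_le_add_right (Nat.add_le_add_left ((complexity_pow_le' _ _).trans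
            (Nat.mul_le_mul_left _ (Nat.add_le_add_right (complexity_affineForm_le _ _) 1))) _) 1
      _ ≤ 0 + n * (2 * n + 1 + 1) + 1 :=
          Nat.add_le_add_right (Nat.add_le_add_left (Nat.mul_le_mul_right _ (hd i)) _) 1
      _ = n * (2 * n + 2) + 1 := by ring
  calc ∑ i : Fin s, complexity (C (c i) *
        (C (a₀ i) + ∑ μ ∈ (Finset.univ : Finset (Fin n)), C (a i μ) * X μ) ^ (d i) :
          MvPolynomial (Fin n) ℂ) + s
      ≤ ∑ _i : Fin s, (n * (2 * n + 2) + 1) + s :=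
        Nat.add_le_add_right (Finset.sum_le_sum fun i _ => hterm i) _
    _ = s * (n * (2 * n + 2) + 2) := by
        rw [Finset.sum_const, Finset.card_univ, Fintype.card_fin, smul_eq_mul]; ring

/-- Degree of a member of `sigmaLambdaSigmaSlice n s` is `≤ n`. [cite: NisanWigderson1996, §3] -/
theorem totalDegree_le_of_mem_sigmaLambdaSigmaSlice {s : ℕ} {f : MvPolynomial (Fin n) ℂ}
    (hf : f ∈ sigmaLambdaSigmaSlice n s) : f.totalDegree ≤ n := by
  obtain ⟨c, a₀, a, d, hd, rfl⟩ := hf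
  refine totalDegree_finsetSum_le fun i _ => (totalDegree_mul _ _).trans ?_
  rw [totalDegree_C, zero_add]
  refine (totalDegree_pow _ _).trans ?_
  have h1 : (C (a₀ i) + ∑ μ ∈ (Finset.univ : Finset (Fin n)), C (a i μ) * X μ :
      MvPolynomial (Fin n) ℂ).totalDegree ≤ 1 := by
    refine (totalDegree_add _ _).trans (max_le ?_ ?_)
    · rw [totalDegree_C]; exact Nat.zero_le _
    · refine totalDegree_finsetSum_le fun μ _ => (totalDegree_mul _ _).trans ?_
      rw [totalDegree_C, zero_add]
      exact (totalDegree_X (R := ℂ) μ).le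
  calc d i * _ ≤ n * 1 := Nat.mul_le_mul (hd i) h1
    _ = n := mul_one n

/-- Arithmetic: `n^b (n(2n+2) + 2) ≤ n^(b+3)` for `n ≥ 3`. [folklore] -/
theorem sls_arith {b : ℕ} (hn : 3 ≤ n) : n ^ b * (n * (2 * n + 2) + 2) ≤ n ^ (b + 3) := by
  have h : n * (2 * n + 2) + 2 ≤ n ^ 3 := by
    calc n * (2 * n + 2) + 2 ≤ n * (n * n) := by nlinarith
      _ = n ^ 3 := by ring
  calc n ^ b * (n * (2 * n + 2) + 2) ≤ n ^ b * n ^ 3 := Nat.mul_le_mul_left _ h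
    _ = n ^ (b + 3) := by ring

/-- **The diagonal depth-3 slice is a sub-slice of the crux's class**: for `n ≥ 3`,
`sigmaLambdaSigmaSlice n (n^b) ⊆ SmallCircuits ℂ n (b + 3)`. [cite: NisanWigderson1996, §3] -/
theorem sigmaLambdaSigmaSlice_subset_smallCircuits {b : ℕ} (hn : 3 ≤ n) :
    sigmaLambdaSigmaSlice n (n ^ b) ⊆ SmallCircuits ℂ n (b + 3) := fun _ hf =>
  ⟨totalDegree_le_of_mem_sigmaLambdaSigmaSlice hf,
    (complexity_le_of_mem_sigmaLambdaSigmaSlice hf).trans (sls_arith hn)⟩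

/-- **The quadratic formula slice is a sub-slice of the crux's class**: degree `≤ n` and
fan-in-two formula size `≤ n²/20` give `SmallCircuits ℂ n 2` (`L ≤ L_e`,
`complexity_le_formulaComplexity_holds`). [cite: Burgisser2000, §2.1] -/
theorem formulaSlice_subset_smallCircuits :
    {f : MvPolynomial (Fin n) ℂ | f.totalDegree ≤ n ∧ formulaComplexity f ≤ n * n / 20} ⊆
      SmallCircuits ℂ n 2 := by
  rintro f ⟨hdeg, hE⟩
  refine ⟨hdeg, (complexity_le_formulaComplexity_holds f).trans (hE.trans ?_)⟩
  calc n * n / 20 ≤ n * n := Nat.div_le_self _ _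
    _ = n ^ 2 := by ring

end sls

/-! ## The union of the classical slices sits inside the crux's class -/
section union

variable {n : ℕ}

/-- **`classicalSlices n (n^b) ⊆ SmallCircuits ℂ n (2b + 4)`** for `n ≥ 4`: every one of the five
classical models at size/width `n^b` is a degree-`≤ n` polynomial of circuit size `≤ n^{2b+4}`.
[cite: ForbesShpilkaVolk2018, Cor. 5] -/
theorem classicalSlices_subset_smallCircuits {b : ℕ} (hn : 4 ≤ n) :
    classicalSlices n (n ^ b) ⊆ SmallCircuits ℂ n (2 * b + 4) := by
  have hn1 : 1 ≤ n := by omega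
  have hn3 : 3 ≤ n := by omega
  have hb3 : SmallCircuits ℂ n (b + 3) ⊆ SmallCircuits ℂ n (2 * b + 4) :=
    smallCircuits_mono ℂ (by omega) hn1
  intro f hf
  simp only [classicalSlices, Set.mem_union] at hf
  rcases hf with (((h | (h | h)) | h) | h)
  · exact hb3 (sigmaLambdaSigmaSlice_subset_smallCircuits hn3 h)
  · exact hb3 (sigmaPiSigmaSlice_subset_smallCircuits hn3 h)
  · exact hb3 (sigmaPiSigmaLowDegSlice_subset_smallCircuits hn3 h)
  · exact roabpSlice_subset_smallCircuits hn h
  · exact smallCircuits_mono ℂ (by omega) hn1 (formulaSlice_subset_smallCircuits h)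

/-- **The capstone as an FSV-natural proof RELATIVE to a slice of the crux's class**: for
`n ≥ 162 · 16^b` the level-`21` certificate `classicalCert n` is a natural proof against
`SmallCircuits ℂ n (2b+4) ∩ classicalSlices n (n^b)` — the part of the crux's class at exponent
`2b + 4` cut out by the classical models (and that intersection IS `classicalSlices n (n^b)`).
Honest framing: a relative natural proof in the sense of the narrowed barrier entry
`AlgebraicNaturalProofsNarrow`; nothing is claimed about the whole of `SmallCircuits ℂ n (2b+4)`.
[cite: ForbesShpilkaVolk2018, Def. 1 and Thm. 4] -/
theorem isNaturalProof_classicalCert_inter {b : ℕ} (hn : 162 * 16 ^ b ≤ n) :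
    IsNaturalProof (degLEMonomials n) (SmallCircuits ℂ n (2 * b + 4) ∩ classicalSlices n (n ^ b))
      (Distinguishers ℂ n 21) (classicalCert n) := by
  have h4 : 4 ≤ n :=
    (le_trans (by norm_num) (Nat.mul_le_mul_left 162 (Nat.one_le_pow b 16 (by norm_num)))).trans hn
  rw [Set.inter_eq_right.mpr (classicalSlices_subset_smallCircuits h4)]
  exact isNaturalProof_classicalCert hn

end union

end Summit.ValiantsHypothesis.ValiantsHypothesis.Theorems.BarrierLever.ModelAxis

end
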